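import Literature.Probability.Percolation.FourArmGarbanBoxPivotal
import Literature.Probability.Percolation.CrossingClusterBlockEstimate
import HarnessLib

/-!
# Docking the arms of Garban's square to its circuits (the deterministic half of (B.4), for `X`)

Topic `Literature/Probability/Percolation`; proof-only support file for the named fact
`Literature.Probability.Percolation.Garban2011_fourArm_multiscale` (`FourArmGarban.lean`;
C. Garban, Appendix B of O. Schramm, S. Smirnov, Ann. Probab. 39 (2011), Lemma B.1). Bond
percolation on `ℤ²`. No definition, no named fact.

Garban (the two displays before (B.6)): on `{C_j = 1}` — an open circuit `O` in the collar
`S_j ⊂ Q_j` — the open arms entering `Q_j` are glued through the circuit and `Q` is crossed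
(`X = 1`); on `{C_j = -1}` — a closed dual circuit `Δ` in `S_j*` — no open arm can cross the
collar and `Q` is not crossed (`X = -1`). This file proves the two implications for the tree's
concrete crossing variable `squareReach (4n)` (`X = crossingSign`,
`FourArmGarbanCrossingEvent.lean`) and a block `c + B(s')` inside the collar `c + A_{a',b'}`:

* `squareReach_of_squareReach_union_of_openCircuitInAnnulusAt` — **docking to the open
  circuit**: if `Q` is crossed once all pairs of `c + B(s')` are opened (`s' + 1 ≤ a'`) and `ω`
  has an open circuit of `c + A_{a',b'}`, then `Q` is crossed in `ω` itself: the crossing either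
  avoids the block, or its initial and final segments enter `c + B(a'-1)` from outside
  `c + B(b')`, hence both meet the circuit (`InwardDocking.lean`), which joins them;
* `not_squareReach_of_dualCircuitInAnnulusAt` — **blocking by the closed dual circuit**: if `Q`
  is not crossed once all pairs of `c + B(s')` are closed (`s' + 2 ≤ a'`) and `ω` has a closed dual
  circuit of `c + A*_{a',b'}`, then `Q` is not crossed in `ω`: a crossing would have to enter the
  block, and its initial segment would be an open radial crossing of the collar, which a closed
  dual circuit forbids (`RadialCrossingDuality.lean`);
* recentring lemmas: `dualConfig_inter_edgeSet`, `dualConfig_relabel_shift` (duality commutes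
  with translations), `relabel_shift_mem_dualCircuitInAnnulusAt`,
  `inter_edgeSet_mem_openCircuitInAnnulusAt`; the recentred radial duality lemma
  `not_mem_dualCircuitInAnnulusAt_of_openWalk` is the tree's (`CrossingClusterBlockEstimate.lean`).

These are the inputs `hFO`, `hFD` of the block covariance lemma
(`FourArmGarbanBlockCovariance.lean`) in the docking step of Garban's (B.4).

## References

* O. Schramm, S. Smirnov (appendix by C. Garban), Ann. Probab. 39 (2011), Appendix B, proof of
  Lemma B.1 (the two displays before (B.6)) [SchrammSmirnov2011].
* H. Kesten, *Percolation theory for mathematicians* (1982), §2.2–2.3 (circuits meet radial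
  crossings; primal/dual exclusion) [KestenPTM1982].

Tree: `boxPivotal`, `BoxInside` and its API, `squareReach_of_walk_congr`
(`FourArmGarbanBoxPivotal.lean`), `openConnIn_shift_box_of_inward_walks_of_openCircuitInAnnulusAt`,
`forall_edges_map_shift_mem_relabel` (`InwardDocking.lean`),
`not_mem_dualCircuitInAnnulusAt_of_openWalk` (`CrossingClusterBlockEstimate.lean`),
`relabel_shift_mem_openCircuitInAnnulusAt`, `openCircuitInAnnulusAt`, `dualCircuitInAnnulusAt`
(`FourArmGarbanCircuitBits.lean`), `map_shift_mem_dualConfig_relabel_iff`, `exists_prefix_exit`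
(`FourArmGarbanTwoArms.lean`), `exists_prefix_first_mem` (`RSWLemma.lean`),
`exists_walk_of_mem_openConnIn` (`PlanarDuality.lean`), `ZdPivotal.sub_mem_box_succ_of_adj`
(`ZdPivotalFourArm.lean`).
-/

noncomputable section

namespace Literature.Probability.Percolation

open _root_.MeasureTheory Set LatticeModels LatticeModels.DiscreteDobrushin

/-! ### Lattice restriction, duality and translations -/

/-- Restricting a configuration to lattice edges does not change its open circuits. [folklore] -/
theorem inter_edgeSet_mem_openCircuitInAnnulusAt {c : Site 2} {a b : ℕ} {ω : BondConfig (Site 2)}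
    (h : ω ∈ openCircuitInAnnulusAt c a b) : ω ∩ (zdGraph 2).edgeSet ∈ openCircuitInAnnulusAt c a b := by
  obtain ⟨u, w, hc, hs, he, ho⟩ := h
  exact ⟨u, w, hc, hs, fun e he' => ⟨he e he', w.edges_subset_edgeSet he'⟩, ho⟩

/-- Restricting a configuration to lattice edges does not change its dual configuration
(non-lattice pairs are fixed by `dualEdge` and are not lattice edges). [folklore] -/
theorem dualConfig_inter_edgeSet (ω : BondConfig (Site 2)) :
    dualConfig (ω ∩ (zdGraph 2).edgeSet) = dualConfig ω := by
  ext e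
  simp only [mem_dualConfig_iff, mem_inter_iff]
  constructor
  · rintro ⟨hE, h⟩
    refine ⟨hE, fun e' he' heq => ?_⟩
    by_cases hE' : e' ∈ (zdGraph 2).edgeSet
    · exact h e' ⟨he', hE'⟩ heq
    · rw [dualEdge_of_not_mem hE'] at heq
      exact hE' (heq ▸ hE)
  · rintro ⟨hE, h⟩
    exact ⟨hE, fun e' he' => h e' he'.1⟩

/-- Restricting to lattice edges does not change the closed dual circuit event. [folklore] -/
theorem inter_edgeSet_mem_dualCircuitInAnnulusAt_iff {c : Site 2} {a b : ℕ} {ω : BondConfig (Site 2)} :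
    ω ∩ (zdGraph 2).edgeSet ∈ dualCircuitInAnnulusAt c a b ↔ ω ∈ dualCircuitInAnnulusAt c a b := by
  simp only [dualCircuitInAnnulusAt, mem_preimage, dualConfig_inter_edgeSet]

/-- **Duality commutes with translations**: the dual configuration of the translate is the
translate of the dual configuration. [folklore] -/
theorem dualConfig_relabel_shift (v : Site 2) (ω : BondConfig (Site 2)) :
    dualConfig (BondConfig.relabel (sym2Equiv (Site.shift v)) ω) =
      BondConfig.relabel (sym2Equiv (Site.shift v)) (dualConfig ω) := by
  ext e
  set d : Sym2 (Site 2) := Sym2.map (Site.shift (-v)) e with hd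
  have he : e = Sym2.map (Site.shift v) d := by
    rw [hd, Sym2.map_map]
    have : (Site.shift v ∘ Site.shift (-v) : Site 2 → Site 2) = id := by
      funext x; simp
    rw [this, Sym2.map_id, id]
  rw [he, map_shift_mem_dualConfig_relabel_iff, BondConfig.mem_relabel_iff, sym2Equiv_symm,
    sym2Equiv_apply, Sym2.map_map]
  have : ((Site.shift v).symm ∘ Site.shift v : Site 2 → Site 2) = id := by
    funext x; simp
  rw [this, Sym2.map_id, id]

/-- **Transport of the closed dual circuit event by a translation.** [folklore] -/
theorem relabel_shift_mem_dualCircuitInAnnulusAt {c v : Site 2} {a b : ℕ} {ω : BondConfig (Site 2)}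
    (h : ω ∈ dualCircuitInAnnulusAt c a b) :
    BondConfig.relabel (sym2Equiv (Site.shift v)) ω ∈ dualCircuitInAnnulusAt (c + v) a b := by
  rw [dualCircuitInAnnulusAt, mem_preimage] at h ⊢
  rw [dualConfig_relabel_shift]
  exact relabel_shift_mem_openCircuitInAnnulusAt h

/-- Translates of lattice configurations are lattice configurations. [folklore] -/
theorem relabel_shift_subset_edgeSet (v : Site 2) {ω : BondConfig (Site 2)}
    (hω : ω ⊆ (zdGraph 2).edgeSet) :
    (BondConfig.relabel (sym2Equiv (Site.shift v)) ω : BondConfig (Site 2)) ⊆ (zdGraph 2).edgeSet := by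
  intro e he
  rw [BondConfig.mem_relabel_iff] at he
  have := hω he
  rw [sym2Equiv_symm] at this
  have h2 := (sym2Equiv_mem_edgeSet_iff (zdShiftIso v) ((sym2Equiv (Site.shift v).symm) e)).2 this
  have h3 : sym2Equiv (zdShiftIso v).toEquiv ((sym2Equiv (Site.shift v).symm) e) = e := by
    rw [sym2Equiv_apply, sym2Equiv_apply, Sym2.map_map]
    have : ((zdShiftIso v).toEquiv ∘ (Site.shift v).symm : Site 2 → Site 2) = id := by
      funext x
      show (Site.shift v).symm x + v = x
      simp
    rw [this, Sym2.map_id, id]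
  rwa [h3] at h2

/-! ### Docking to the open circuit: `F ∩ O ⇒ X = 1` -/

section Docking

variable {n : ℕ} {c : Site 2} {s' a' b' r : ℕ}

/-- **Edges of a segment of a completed-open walk, off the opened pairs and inside the square, are
genuinely open lattice edges.** [folklore] -/
theorem BoxInside.forall_edges_mem_of_segment (hn : 1 ≤ n) {r' : ℕ} (hcb : BoxInside n c r')
    {z v : Site 2} (Q : (zdGraph 2).Walk z v) {a w : Site 2} (P : (zdGraph 2).Walk a w)
    {ω : BondConfig (Site 2)} {B' : Set (Sym2 (Site 2))}
    (hQbox : ∀ x ∈ Q.support, x - c ∈ box 2 r') (hQE : ∀ e ∈ Q.edges, e ∈ P.edges)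
    (hPbc : ∀ e ∈ P.edges, e ∈ (squareDobrushin (4 * n)).bcBondConfig (ω ∪ B'))
    (hPnotB : ∀ e ∈ P.edges, e ∉ B') : ∀ e ∈ Q.edges, e ∈ ω ∩ (zdGraph 2).edgeSet := by
  intro e he
  obtain ⟨d, hd, rfl⟩ := List.mem_map.1 (by rwa [SimpleGraph.Walk.edges] at he)
  exact ⟨hcb.mem_of_bc_union hn (hQbox _ (Q.dart_fst_mem_support_of_mem_darts hd))
    (hPbc _ (hQE _ he)) (hPnotB _ (hQE _ he)), Q.edges_subset_edgeSet he⟩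

/-- An inward segment of a walk of `Q`: from the first visit of `c + B(s')` backwards to the
last exit of `c + B(b')`, reversed — a walk from a site `z` with `z - c ∉ B(b')` to the visit,
inside `c + B(b'+1)`, using edges of the walk. [folklore] -/
theorem exists_inward_segment {a v : Site 2} (P : (zdGraph 2).Walk a v) (hv : v - c ∈ box 2 b')
    (ha : a - c ∉ box 2 b') :
    ∃ (z : Site 2) (Q : (zdGraph 2).Walk z v), z - c ∉ box 2 b' ∧ z ∈ P.support ∧
      (∀ x ∈ Q.support, x - c ∈ box 2 (b' + 1)) ∧ (∀ x ∈ Q.support, x ∈ P.support) ∧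
      ∀ e ∈ Q.edges, e ∈ P.edges := by
  have hvA : v ∈ ({x | x - c ∈ box 2 b'} : Set (Site 2)) := hv
  have haA : a ∉ ({x | x - c ∈ box 2 b'} : Set (Site 2)) := ha
  obtain ⟨x, z, q, hxz, hz, hqA, hqS, hqE, hlast⟩ :=
    exists_prefix_exit (A := {x | x - c ∈ box 2 b'}) P.reverse hvA haA
  have hzP : z ∈ P.support := by
    have := P.reverse.snd_mem_support_of_mem_edges hlast
    rwa [SimpleGraph.Walk.support_reverse, List.mem_reverse] at this
  refine ⟨z, (q.concat hxz).reverse, hz, hzP, fun y hy => ?_, fun y hy => ?_, fun e he => ?_⟩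
  · rw [SimpleGraph.Walk.support_reverse, List.mem_reverse, SimpleGraph.Walk.support_concat,
      List.mem_append, List.mem_singleton] at hy
    rcases hy with hy | rfl
    · exact box_mono 2 (Nat.le_succ _) (hqA y hy)
    · exact ZdPivotal.sub_mem_box_succ_of_adj (hqA x q.end_mem_support) hxz
  · rw [SimpleGraph.Walk.support_reverse, List.mem_reverse, SimpleGraph.Walk.support_concat,
      List.mem_append, List.mem_singleton] at hy
    rcases hy with hy | rfl
    · have := hqS y hy
      rwa [SimpleGraph.Walk.support_reverse, List.mem_reverse] at this
    · exact hzP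
  · rw [SimpleGraph.Walk.edges_reverse, List.mem_reverse, SimpleGraph.Walk.edges_concat,
      List.concat_eq_append, List.mem_append, List.mem_singleton] at he
    rcases he with he | rfl
    · have := hqE e he
      rwa [SimpleGraph.Walk.edges_reverse, List.mem_reverse] at this
    · have := hlast
      rwa [SimpleGraph.Walk.edges_reverse, List.mem_reverse] at this

/-- **Docking to the open circuit** (Garban: on `{C_j = 1}` and `Q_j` pivotal, the open arms are
joined through the circuit and `Q` is crossed). Let `c + B(r)` be inside the square
(`BoxInside n c r`), `s' + 1 ≤ a'`, `1 ≤ a' ≤ b'`, `b' + 1 ≤ r`. If `ω` has an open circuit of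
`c + A_{a',b'}` around `c` and `Q` is crossed in `ω ∪ boxPairs c s'` (all pairs of the small block
opened), then `Q` is crossed in `ω`. [cite: SchrammSmirnov2011, Appendix B, proof of Lemma B.1 (the display before (B.6), C_j = 1)] -/
theorem squareReach_of_squareReach_union_of_openCircuitInAnnulusAt (hn : 1 ≤ n)
    (hc : BoxInside n c r) (hs'a : s' + 1 ≤ a') (ha : 1 ≤ a') (hab : a' ≤ b') (hbr : b' + 1 ≤ r)
    {ω : BondConfig (Site 2)} (hO : ω ∈ openCircuitInAnnulusAt c a' b')
    (hF : squareReach (4 * n) (ω ∪ boxPairs c s')) : squareReach (4 * n) ω := by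
  set L := 4 * n with hL
  set B' : Set (Sym2 (Site 2)) := boxPairs c s' with hB'
  obtain ⟨a, b, W, ha0, hb0, hWs, hWe⟩ := hF
  -- pairs of the small block have both endpoints in `c + B(s')`
  have hpairB : ∀ u v : Site 2, s(u, v) ∈ B' → u - c ∈ box 2 s' := fun u v huv =>
    (mem_boxPairs_iff.1 huv) u (Sym2.mem_mk_left _ _)
  have hstat : ∀ e : Sym2 (Site 2), e ∉ B' → (e ∈ ω ∪ B' ↔ e ∈ ω) := fun e heB =>
    ⟨fun h => h.resolve_right heB, fun h => Or.inl h⟩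
  by_cases hvisit : ∃ z ∈ W.support, z ∈ ({v | v - c ∈ box 2 s'} : Set (Site 2))
  swap
  · -- the crossing avoids the block: it is a crossing of `ω`
    simp only [not_exists, not_and] at hvisit
    refine squareReach_of_walk_congr W ha0 hb0 hWs hWe fun e he => hstat e fun heB => ?_
    obtain ⟨d, hd, rfl⟩ := List.mem_map.1 (by rwa [SimpleGraph.Walk.edges] at he)
    exact hvisit _ (W.dart_fst_mem_support_of_mem_darts hd) (hpairB _ _ heB)
  -- geometry
  have hs'b : s' ≤ b' := by omega
  have hbr' : b' + 1 ≤ r := hbr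
  have ha_far : a - c ∉ box 2 b' := fun h =>
    hc.sub_notMem_box_of_apply_zero_eq_zero ha0 (box_mono 2 (by omega) h)
  have hb_far : b - c ∉ box 2 b' := fun h =>
    hc.sub_notMem_box_of_apply_zero_succ hb0 (box_mono 2 (by omega) h)
  -- the two prefixes up to the first visits of the block, from either end
  obtain ⟨v₁, hv₁, P₁, hP₁s, hP₁e, hP₁d⟩ := exists_prefix_first_mem W hvisit
  have hv₁ : v₁ - c ∈ box 2 s' := hv₁
  have hvisit' : ∃ z ∈ W.reverse.support, z ∈ ({v | v - c ∈ box 2 s'} : Set (Site 2)) := by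
    obtain ⟨z, hz, hzO⟩ := hvisit
    exact ⟨z, by rwa [SimpleGraph.Walk.support_reverse, List.mem_reverse], hzO⟩
  obtain ⟨v₂, hv₂, P₂, hP₂s, hP₂e, hP₂d⟩ := exists_prefix_first_mem W.reverse hvisit'
  have hv₂ : v₂ - c ∈ box 2 s' := hv₂
  have hP₁notB : ∀ e ∈ P₁.edges, e ∉ B' := fun e he heB => by
    obtain ⟨d, hd, rfl⟩ := List.mem_map.1 (by rwa [SimpleGraph.Walk.edges] at he)
    exact hP₁d d hd (hpairB _ _ heB)
  have hP₂notB : ∀ e ∈ P₂.edges, e ∉ B' := fun e he heB => by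
    obtain ⟨d, hd, rfl⟩ := List.mem_map.1 (by rwa [SimpleGraph.Walk.edges] at he)
    exact hP₂d d hd (hpairB _ _ heB)
  have hWe' : ∀ e ∈ W.reverse.edges, e ∈ (squareDobrushin L).bcBondConfig (ω ∪ B') := fun e he => by
    rw [SimpleGraph.Walk.edges_reverse, List.mem_reverse] at he
    exact hWe e he
  have hP₁bc : ∀ e ∈ P₁.edges, e ∈ (squareDobrushin L).bcBondConfig (ω ∪ B') := fun e he =>
    hWe e (hP₁e e he)
  have hP₂bc : ∀ e ∈ P₂.edges, e ∈ (squareDobrushin L).bcBondConfig (ω ∪ B') := fun e he =>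
    hWe' e (hP₂e e he)
  -- the inward segments `Q₁ : z₁ ⟶ v₁`, `Q₂ : z₂ ⟶ v₂` inside `c + B(b'+1)`
  have hv₁b : v₁ - c ∈ box 2 b' := box_mono 2 hs'b hv₁
  have hv₂b : v₂ - c ∈ box 2 b' := box_mono 2 hs'b hv₂
  obtain ⟨z₁, Q₁, hz₁, hz₁P, hQ₁box, hQ₁S, hQ₁E⟩ := exists_inward_segment P₁ hv₁b ha_far
  obtain ⟨z₂, Q₂, hz₂, hz₂P, hQ₂box, hQ₂S, hQ₂E⟩ := exists_inward_segment P₂ hv₂b hb_far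
  have hcb : BoxInside n c (b' + 1) := hc.mono hbr'
  -- the segments are genuinely `ω`-open (edges of the prefixes, off the block, in the interior)
  have hQ₁ω := hcb.forall_edges_mem_of_segment hn Q₁ P₁ hQ₁box hQ₁E hP₁bc hP₁notB
  have hQ₂ω := hcb.forall_edges_mem_of_segment hn Q₂ P₂ hQ₂box hQ₂E hP₂bc hP₂notB
  -- docking through the circuit (for the lattice part of `ω`)
  have hdock := openConnIn_shift_box_of_inward_walks_of_openCircuitInAnnulusAt ha hab (Nat.le_succ b')
    (inter_edgeSet_mem_openCircuitInAnnulusAt hO) Q₁ Q₂ hQ₁ω hQ₂ω hQ₁box hQ₂box hz₁ hz₂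
    (box_mono 2 (by omega) hv₁) (box_mono 2 (by omega) hv₂)
  obtain ⟨R, hRs, hRe⟩ := exists_walk_of_mem_openConnIn inter_subset_right hdock
  have hRbox : ∀ x ∈ R.support, x - c ∈ box 2 (b' + 1) := fun x hx => by
    obtain ⟨y, hy, rfl⟩ := hRs x hx
    simpa using hy
  -- the junction walk `a ⟶ z₁ ⟶ z₂ ⟶ b`
  set T : (zdGraph 2).Walk a b :=
    ((P₁.takeUntil z₁ hz₁P).append R).append (P₂.takeUntil z₂ hz₂P).reverse with hT
  refine ⟨a, b, T, ha0, hb0, fun x hx => ?_, fun e he => ?_⟩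
  · rw [hT, SimpleGraph.Walk.support_append, SimpleGraph.Walk.support_append,
      SimpleGraph.Walk.support_reverse] at hx
    simp only [List.mem_append] at hx
    rcases hx with (hx | hx) | hx
    · exact hWs x (hP₁s x (P₁.support_takeUntil_subset_support hz₁P hx))
    · have := hcb.site_props hn (hRbox x (List.mem_of_mem_tail hx))
      exact ⟨this.1, this.2.1⟩
    · have hx' : x ∈ W.support := by
        have := hP₂s x (P₂.support_takeUntil_subset_support hz₂P
          (List.mem_reverse.1 (List.mem_of_mem_tail hx)))
        rwa [SimpleGraph.Walk.support_reverse, List.mem_reverse] at this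
      exact hWs x hx'
  · rw [hT, SimpleGraph.Walk.edges_append, SimpleGraph.Walk.edges_append,
      SimpleGraph.Walk.edges_reverse] at he
    simp only [List.mem_append, List.mem_reverse] at he
    rcases he with (he | he) | he
    · have he' : e ∈ P₁.edges := P₁.edges_takeUntil_subset_edges hz₁P he
      exact (mem_bcBondConfig_congr _ (hstat e (hP₁notB e he'))).1 (hP₁bc e he')
    · obtain ⟨d, hd, rfl⟩ := List.mem_map.1 (by rwa [SimpleGraph.Walk.edges] at he)
      exact hcb.mem_bcBondConfig hn d.adj (hRbox _ (R.dart_fst_mem_support_of_mem_darts hd))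
        (hRbox _ (R.dart_snd_mem_support_of_mem_darts hd)) (hRe _ he).1
    · have he' : e ∈ P₂.edges := P₂.edges_takeUntil_subset_edges hz₂P he
      exact (mem_bcBondConfig_congr _ (hstat e (hP₂notB e he'))).1 (hP₂bc e he')

/-! ### Blocking by the closed dual circuit: `F* ∩ Δ ⇒ X = -1` -/

/-- A site just outside `c + B(b'+1)` is, after the index shift `(1,1)` of double duality, still
outside `c + B(b')`. [folklore] -/
theorem sub_sub_one_notMem_box {c z : Site 2} {b' : ℕ} (hz : z - c ∉ box 2 (b' + 1)) :
    z - c - 1 ∉ box 2 b' := by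
  intro h
  apply hz
  rw [mem_box] at h ⊢
  intro i
  have := h i
  simp only [Pi.sub_apply, Pi.one_apply] at this ⊢
  push_cast at this ⊢
  constructor <;> omega

/-- A site of `c + B(s')` is, after the index shift `(1,1)`, inside `c + B(a'-1)` as soon as
`s' + 2 ≤ a'`. [folklore] -/
theorem sub_sub_one_mem_box {c v : Site 2} {s' a' : ℕ} (hs'a : s' + 2 ≤ a') (hv : v - c ∈ box 2 s') :
    v - c - 1 ∈ box 2 (a' - 1) := by
  rw [mem_box] at hv ⊢
  intro i
  have := hv i
  simp only [Pi.sub_apply, Pi.one_apply] at this ⊢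
  have h1 : ((a' - 1 : ℕ) : ℤ) = (a' : ℤ) - 1 := by push_cast [Nat.cast_sub (show 1 ≤ a' by omega)]; ring
  rw [h1]
  constructor <;> omega

/-- **Blocking by the closed dual circuit** (Garban: on `{C_j = -1}` and `Q_j` pivotal, the dual
arms are joined through the dual circuit and `Q` is not crossed). Let `c + B(r)` be inside the
square, `s' + 2 ≤ a' ≤ b'`, `b' + 2 ≤ r`. If `ω` has a closed dual circuit of `c + A*_{a',b'}`
and `Q` is not crossed in `ω ∖ boxPairs c s'` (all pairs of the small block closed), then `Q` is
not crossed in `ω`: a crossing of `Q` in `ω` would have to visit the block, and its segment from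
its last exit of `c + B(b'+1)` to that visit is an open radial crossing of the collar.
[cite: SchrammSmirnov2011, Appendix B, proof of Lemma B.1 ("the opposite bound for the term conditioned on C_j = -1")] -/
theorem not_squareReach_of_dualCircuitInAnnulusAt (hn : 1 ≤ n) (hc : BoxInside n c r)
    (hs'a : s' + 2 ≤ a') (hab : a' ≤ b') (hbr : b' + 2 ≤ r)
    {ω : BondConfig (Site 2)} (hD : ω ∈ dualCircuitInAnnulusAt c a' b')
    (hF : ¬ squareReach (4 * n) (ω \ boxPairs c s')) : ¬ squareReach (4 * n) ω := by
  set L := 4 * n with hL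
  set B' : Set (Sym2 (Site 2)) := boxPairs c s' with hB'
  rintro ⟨a, b, W, ha0, hb0, hWs, hWe⟩
  have ha : 1 ≤ a' := by omega
  have hpairB : ∀ u v : Site 2, s(u, v) ∈ B' → u - c ∈ box 2 s' := fun u v huv =>
    (mem_boxPairs_iff.1 huv) u (Sym2.mem_mk_left _ _)
  by_cases hvisit : ∃ z ∈ W.support, z ∈ ({v | v - c ∈ box 2 s'} : Set (Site 2))
  swap
  · -- the crossing avoids the block: it is a crossing of `ω ∖ B'`
    simp only [not_exists, not_and] at hvisit
    refine hF (squareReach_of_walk_congr W ha0 hb0 hWs hWe fun e he => ⟨fun h => ⟨h, fun heB => ?_⟩,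
      fun h => h.1⟩)
    obtain ⟨d, hd, rfl⟩ := List.mem_map.1 (by rwa [SimpleGraph.Walk.edges] at he)
    exact hvisit _ (W.dart_fst_mem_support_of_mem_darts hd) (hpairB _ _ heB)
  -- the prefix up to the first visit, and its inward segment from outside `c + B(b'+1)`
  obtain ⟨v₁, hv₁, P₁, -, hP₁e, -⟩ := exists_prefix_first_mem W hvisit
  have hv₁ : v₁ - c ∈ box 2 s' := hv₁
  have ha_far : a - c ∉ box 2 (b' + 1) := fun h =>
    hc.sub_notMem_box_of_apply_zero_eq_zero ha0 (box_mono 2 (by omega) h)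
  have hv₁b : v₁ - c ∈ box 2 (b' + 1) := box_mono 2 (by omega) hv₁
  obtain ⟨z₁, Q₁, hz₁, -, hQ₁box, -, hQ₁E⟩ := exists_inward_segment P₁ hv₁b ha_far
  -- `Q₁` is genuinely `ω`-open: its edges are edges of `W`, inside `c + B(b'+2) ⊆ c + B(r)`
  have hcb : BoxInside n c (b' + 1 + 1) := hc.mono (by omega)
  have hP₁bc : ∀ e ∈ P₁.edges, e ∈ (squareDobrushin L).bcBondConfig (ω ∪ ∅) := fun e he => by
    rw [union_empty]; exact hWe _ (hP₁e e he)
  have hQ₁ω := hcb.forall_edges_mem_of_segment hn Q₁ P₁ hQ₁box hQ₁E hP₁bc (fun _ _ h => h)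
  -- the radial crossing `Q₁.reverse : v₁ ⟶ z₁` excludes the dual circuit
  refine not_mem_dualCircuitInAnnulusAt_of_openWalk ha hab (inter_subset_right) Q₁.reverse
    (fun e he => hQ₁ω e (by rwa [SimpleGraph.Walk.edges_reverse, List.mem_reverse] at he))
    (sub_sub_one_mem_box hs'a hv₁) (sub_sub_one_notMem_box ?_)
    (inter_edgeSet_mem_dualCircuitInAnnulusAt_iff.2 hD)
  -- `z₁ - c ∉ B(b'+1)`: the inward segment was taken with respect to the radius `b' + 1`
  exact hz₁

end Docking

end Literature.Probability.Percolation
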